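import Literature.NumberTheory.LFunctions.Zhang2022.AppendixALemma83LocalEstimates
import HarnessLib

/-!
# Zhang (2022), rescue GAP/BED (D-0124 (3)(4)): Appendix A local estimates u014 / u015 GUARD-FREE
# (the first two inputs of the Lemma 8.3 chain re-keyed away from Assumption (A))

Topic `Literature/NumberTheory/LFunctions/Zhang2022` (Landau–Siegel audit tree; verdict-neutral).
Y. Zhang, *Discrete mean estimates and the Landau–Siegel zero*, arXiv:2211.02515v1 (2022)
[Zhang2022LandauSiegel] — **an unrefereed manuscript under adjudication; nothing in this file asserts or
denies its Theorems 1–2, and nothing here is a claim about Landau–Siegel zeros. The programme SEARCHES and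
TYPES; no claim about Landau–Siegel zeros, Theorems 1–2 of arXiv:2211.02515 or a repaired Margin232 until a
kernel theorem says so.**

The typed campaign nodes `Typed.AppendixA1.StepA_u014 c′` (App. A p. 102, tex L5047:
`λ̃(q,dh;1−β_j) = (1−u)² + O(α log q/q)`) and `StepA_u015 c′` (tex L5051: the first factor of `𝔱_j` is
`1 − vu + O(α log q/q)`) are typed, like every Appendix A node, under the standing guard `AssumptionA D χ →`.
Their tree proofs (`Lemma83.stepA_u014_holds`, `stepA_u015_holds`, file `AppendixALemma83LocalEstimates`)
never use that guard: the displays are elementary perturbation bounds in `α`, `β_i` and `q`. This file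
re-runs the two proofs VERBATIM with the guard binder deleted, giving the GUARD-FREE statements
`stepA_u014_free` / `stepA_u015_free` (same constants `1372` / `504`, same largeness threshold
`D ≥ exp(10|c′|π + 400)`). They are the first inputs of the guard-free Lemma 8.3 (relative) chain
(rescue GAP row G-31: the Lemma 8.4 leaf at (A)-exponent 15 is conditional only on a guard-free / `𝓛⁻¹⁵`
Lemma 8.3, `Lemma84.lemma84Rel_pow15_of_lemma83Rel_pow15`). Theorems only; no definition, no named fact;
nothing about (A) itself. The private perturbation helpers are copied from the tree file unchanged.

## References

* Y. Zhang, arXiv:2211.02515v1 (2022), Appendix A p. 102; (2.13). [cite: Zhang2022LandauSiegel, App. A]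
-/

noncomputable section

open Complex Real ComplexConjugate Finset

namespace Literature.NumberTheory.LFunctions.Zhang2022.Repair.Gap

open Literature.NumberTheory.LFunctions.Zhang2022
open Literature.NumberTheory.LFunctions.Zhang2022.Skeleton
open Literature.NumberTheory.LFunctions.Zhang2022.Typed.AppendixA1
open Literature.NumberTheory.LFunctions.Zhang2022.Lemma83

/-! ## Generic perturbation bounds -/

/-- `‖q^w − 1‖ ≤ 2|w| log q` for a natural `q ≥ 1` and `|w| log q ≤ 1`
(`q^w = exp(w log q)` and `|e^z − 1| ≤ 2|z|` for `|z| ≤ 1`). [folklore] -/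
private theorem norm_natCast_cpow_sub_one_le {q : ℕ} (hq : 0 < q) {w : ℂ}
    (hw : ‖w‖ * Real.log q ≤ 1) : ‖(q : ℂ) ^ w - 1‖ ≤ 2 * ‖w‖ * Real.log q := by
  have hq0 : (q : ℂ) ≠ 0 := by exact_mod_cast hq.ne'
  have hlog : Complex.log (q : ℂ) = (Real.log q : ℂ) := (Complex.natCast_log).symm
  rw [Complex.cpow_def_of_ne_zero hq0, hlog]
  have hz : ‖(Real.log q : ℂ) * w‖ = ‖w‖ * Real.log q := by
    rw [norm_mul, Complex.norm_real, Real.norm_eq_abs,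
      abs_of_nonneg (Real.log_natCast_nonneg q), mul_comm]
  calc ‖Complex.exp ((Real.log q : ℂ) * w) - 1‖ ≤ 2 * ‖(Real.log q : ℂ) * w‖ :=
        Complex.norm_exp_sub_one_le (by rw [hz]; exact hw)
    _ = 2 * ‖w‖ * Real.log q := by rw [hz]; ring

/-- `q^{−1+w} = q⁻¹·q^w` is within `q⁻¹·2|w| log q` of `u = q⁻¹` (`|w| log q ≤ 1`). [folklore] -/
private theorem norm_cpow_neg_one_add_sub_inv_le {q : ℕ} (hq : 0 < q) {w : ℂ}
    (hw : ‖w‖ * Real.log q ≤ 1) :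
    ‖(q : ℂ) ^ (-1 + w) - (q : ℂ)⁻¹‖ ≤ (q : ℝ)⁻¹ * (2 * ‖w‖ * Real.log q) := by
  have hq0 : (q : ℂ) ≠ 0 := by exact_mod_cast hq.ne'
  rw [Complex.cpow_add _ _ hq0, Complex.cpow_neg_one, ← mul_sub_one, norm_mul, norm_inv,
    Complex.norm_natCast]
  exact mul_le_mul_of_nonneg_left (norm_natCast_cpow_sub_one_le hq hw) (by positivity)

/-- Three-factor Lipschitz bound: if `‖xᵢ − y‖ ≤ δ`, `‖x₀ − y‖ ≤ δ` and all of `‖xᵢ‖, ‖y‖ ≤ 7/4`,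
`‖1 − … ‖`… concretely `‖x₁x₂x₃ − y²x₀‖ ≤ (49/16)·4δ`. [folklore] -/
private theorem norm_mul3_sub_le {x₁ x₂ x₃ x₀ y : ℂ} {δ : ℝ} (h₁ : ‖x₁ - y‖ ≤ δ) (h₂ : ‖x₂ - y‖ ≤ δ)
    (h₃ : ‖x₃ - y‖ ≤ δ) (h₀ : ‖x₀ - y‖ ≤ δ) (n₂ : ‖x₂‖ ≤ 7 / 4) (n₃ : ‖x₃‖ ≤ 7 / 4)
    (ny : ‖y‖ ≤ 7 / 4) : ‖x₁ * x₂ * x₃ - y * y * x₀‖ ≤ 49 / 4 * δ := by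
  have hδ : 0 ≤ δ := le_trans (norm_nonneg _) h₁
  have e : x₁ * x₂ * x₃ - y * y * x₀ =
      (x₁ - y) * x₂ * x₃ + y * (x₂ - y) * x₃ + y * y * ((x₃ - y) - (x₀ - y)) := by ring
  rw [e]
  have t1 : ‖(x₁ - y) * x₂ * x₃‖ ≤ δ * (7 / 4) * (7 / 4) := by
    rw [norm_mul, norm_mul]
    exact mul_le_mul (mul_le_mul h₁ n₂ (norm_nonneg _) hδ) n₃ (norm_nonneg _) (by positivity)
  have t2 : ‖y * (x₂ - y) * x₃‖ ≤ (7 / 4) * δ * (7 / 4) := by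
    rw [norm_mul, norm_mul]
    exact mul_le_mul (mul_le_mul ny h₂ (norm_nonneg _) (by norm_num)) n₃ (norm_nonneg _)
      (by positivity)
  have t3 : ‖y * y * ((x₃ - y) - (x₀ - y))‖ ≤ (7 / 4) * (7 / 4) * (δ + δ) := by
    rw [norm_mul, norm_mul]
    refine mul_le_mul (mul_le_mul ny ny (norm_nonneg _) (by norm_num))
      ((norm_sub_le _ _).trans (add_le_add h₃ h₀)) (norm_nonneg _) (by positivity)
  calc ‖(x₁ - y) * x₂ * x₃ + y * (x₂ - y) * x₃ + y * y * ((x₃ - y) - (x₀ - y))‖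
      ≤ ‖(x₁ - y) * x₂ * x₃‖ + ‖y * (x₂ - y) * x₃‖ + ‖y * y * ((x₃ - y) - (x₀ - y))‖ :=
        norm_add₃_le
    _ ≤ δ * (7 / 4) * (7 / 4) + (7 / 4) * δ * (7 / 4) + (7 / 4) * (7 / 4) * (δ + δ) := by
        linarith
    _ = 49 / 4 * δ := by ring

/-- The shape of `λ̃ = (1−a₁)(1−a₂)(1−a₃)/(1−a₀)` near `aᵢ ≈ u`: if `‖aᵢ − u‖ ≤ δ ≤ 1/4`
(`i = 0,…,3`) and `‖u‖ ≤ 1/2` then `‖λ̃ − (1−u)²‖ ≤ 49δ`. [folklore] -/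
private theorem norm_frac3_sub_sq_le {a₁ a₂ a₃ a₀ u : ℂ} {δ : ℝ} (hδ : δ ≤ 1 / 4)
    (hu : ‖u‖ ≤ 1 / 2) (h₁ : ‖a₁ - u‖ ≤ δ) (h₂ : ‖a₂ - u‖ ≤ δ) (h₃ : ‖a₃ - u‖ ≤ δ)
    (h₀ : ‖a₀ - u‖ ≤ δ) :
    ‖(1 - a₁) * (1 - a₂) * (1 - a₃) / (1 - a₀) - (1 - u) ^ 2‖ ≤ 49 * δ := by
  have hδ0 : 0 ≤ δ := le_trans (norm_nonneg _) h₁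
  have na : ∀ {a : ℂ}, ‖a - u‖ ≤ δ → ‖a‖ ≤ 3 / 4 := fun {a} ha => by
    calc ‖a‖ = ‖(a - u) + u‖ := by ring_nf
      _ ≤ ‖a - u‖ + ‖u‖ := norm_add_le _ _
      _ ≤ 3 / 4 := by linarith
  have nx : ∀ {a : ℂ}, ‖a‖ ≤ 3 / 4 → ‖1 - a‖ ≤ 7 / 4 := fun {a} ha => by
    calc ‖1 - a‖ ≤ ‖(1 : ℂ)‖ + ‖a‖ := norm_sub_le _ _
      _ ≤ 7 / 4 := by rw [norm_one]; linarith
  have hden : 1 / 4 ≤ ‖1 - a₀‖ := by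
    have := norm_sub_norm_le (1 : ℂ) a₀
    rw [norm_one] at this
    linarith [na h₀, abs_norm_sub_norm_le (1 : ℂ) a₀, norm_sub_le (1 : ℂ) a₀,
      norm_le_norm_add_norm_sub' (1 : ℂ) a₀]
  have hden0 : (1 - a₀) ≠ 0 := fun h => by rw [h, norm_zero] at hden; linarith
  have hsub : ∀ {a : ℂ}, ‖a - u‖ ≤ δ → ‖(1 - a) - (1 - u)‖ ≤ δ := fun {a} ha => by
    rw [show (1 - a) - (1 - u) = -(a - u) by ring, norm_neg]; exact ha
  have hN := norm_mul3_sub_le (hsub h₁) (hsub h₂) (hsub h₃) (hsub h₀) (nx (na h₂)) (nx (na h₃))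
    (nx (le_trans hu (by norm_num)))
  have e : (1 - a₁) * (1 - a₂) * (1 - a₃) / (1 - a₀) - (1 - u) ^ 2 =
      ((1 - a₁) * (1 - a₂) * (1 - a₃) - (1 - u) * (1 - u) * (1 - a₀)) / (1 - a₀) := by
    field_simp
  rw [e, norm_div]
  calc ‖(1 - a₁) * (1 - a₂) * (1 - a₃) - (1 - u) * (1 - u) * (1 - a₀)‖ / ‖1 - a₀‖
      ≤ (49 / 4 * δ) / (1 / 4) := div_le_div₀ (by positivity) hN (by norm_num) hden
    _ = 49 * δ := by ring

/-- The shape of the first factor of `𝔱_j`: if `‖X_k − u‖ ≤ δ ≤ 1/4` (`k = 0,1,2`), `‖v‖ ≤ 1`,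
`‖u‖ ≤ 1/2`, then `‖(1−vX₁)(1−vX₂)/(1−vX₀) − (1−vu)‖ ≤ 21δ`. [folklore] -/
private theorem norm_frac2_sub_le {X₁ X₂ X₀ u v : ℂ} {δ : ℝ} (hδ : δ ≤ 1 / 4) (hu : ‖u‖ ≤ 1 / 2)
    (hv : ‖v‖ ≤ 1) (h₁ : ‖X₁ - u‖ ≤ δ) (h₂ : ‖X₂ - u‖ ≤ δ) (h₀ : ‖X₀ - u‖ ≤ δ) :
    ‖(1 - v * X₁) * (1 - v * X₂) / (1 - v * X₀) - (1 - v * u)‖ ≤ 21 * δ := by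
  have hδ0 : 0 ≤ δ := le_trans (norm_nonneg _) h₁
  have na : ∀ {a : ℂ}, ‖a - u‖ ≤ δ → ‖a‖ ≤ 3 / 4 := fun {a} ha => by
    calc ‖a‖ = ‖(a - u) + u‖ := by ring_nf
      _ ≤ ‖a - u‖ + ‖u‖ := norm_add_le _ _
      _ ≤ 3 / 4 := by linarith
  have nva : ∀ {a : ℂ}, ‖a‖ ≤ 3 / 4 → ‖v * a‖ ≤ 3 / 4 := fun {a} ha => by
    rw [norm_mul]; nlinarith [norm_nonneg v, norm_nonneg a]
  have nx : ∀ {a : ℂ}, ‖a‖ ≤ 3 / 4 → ‖1 - v * a‖ ≤ 7 / 4 := fun {a} ha => by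
    calc ‖1 - v * a‖ ≤ ‖(1 : ℂ)‖ + ‖v * a‖ := norm_sub_le _ _
      _ ≤ 7 / 4 := by rw [norm_one]; linarith [nva ha]
  have hsub : ∀ {a : ℂ}, ‖a - u‖ ≤ δ → ‖(1 - v * a) - (1 - v * u)‖ ≤ δ := fun {a} ha => by
    rw [show (1 - v * a) - (1 - v * u) = -(v * (a - u)) by ring, norm_neg, norm_mul]
    nlinarith [norm_nonneg v, norm_nonneg (a - u)]
  have hden : 1 / 4 ≤ ‖1 - v * X₀‖ := by
    linarith [norm_le_norm_add_norm_sub' (1 : ℂ) (v * X₀), nva (na h₀), norm_one (α := ℂ)]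
  have hden0 : (1 - v * X₀) ≠ 0 := fun h => by rw [h, norm_zero] at hden; linarith
  have e : (1 - v * X₁) * (1 - v * X₂) / (1 - v * X₀) - (1 - v * u) =
      ((1 - v * X₁) * (1 - v * X₂) - (1 - v * u) * (1 - v * X₀)) / (1 - v * X₀) := by
    field_simp
  have hN : ‖(1 - v * X₁) * (1 - v * X₂) - (1 - v * u) * (1 - v * X₀)‖ ≤ 21 / 4 * δ := by
    have e2 : (1 - v * X₁) * (1 - v * X₂) - (1 - v * u) * (1 - v * X₀) =
        ((1 - v * X₁) - (1 - v * u)) * (1 - v * X₂) +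
          (1 - v * u) * (((1 - v * X₂) - (1 - v * u)) - ((1 - v * X₀) - (1 - v * u))) := by ring
    rw [e2]
    have t1 : ‖((1 - v * X₁) - (1 - v * u)) * (1 - v * X₂)‖ ≤ δ * (7 / 4) := by
      rw [norm_mul]; exact mul_le_mul (hsub h₁) (nx (na h₂)) (norm_nonneg _) hδ0
    have t2 : ‖(1 - v * u) * (((1 - v * X₂) - (1 - v * u)) - ((1 - v * X₀) - (1 - v * u)))‖ ≤
        (7 / 4) * (δ + δ) := by
      rw [norm_mul]
      exact mul_le_mul (nx (le_trans hu (by norm_num)))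
        ((norm_sub_le _ _).trans (add_le_add (hsub h₂) (hsub h₀))) (norm_nonneg _) (by norm_num)
    calc _ ≤ ‖((1 - v * X₁) - (1 - v * u)) * (1 - v * X₂)‖ +
          ‖(1 - v * u) * (((1 - v * X₂) - (1 - v * u)) - ((1 - v * X₀) - (1 - v * u)))‖ :=
          norm_add_le _ _
      _ ≤ δ * (7 / 4) + (7 / 4) * (δ + δ) := add_le_add t1 t2
      _ = 21 / 4 * δ := by ring
  rw [e, norm_div]
  calc ‖(1 - v * X₁) * (1 - v * X₂) - (1 - v * u) * (1 - v * X₀)‖ / ‖1 - v * X₀‖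
      ≤ (21 / 4 * δ) / (1 / 4) := div_le_div₀ (by positivity) hN (by norm_num) hden
    _ = 21 * δ := by ring



/-! ## Z22:§A.u014 guard-free: `λ̃(q,dh;1−β_j) = (1−u)² + O(α log q/q)` -/

/-- **Z22:§A.u014, GUARD-FREE** (App. A p. 102, tex L5047; twin of `Lemma83.stepA_u014_holds` with the
unused binder `AssumptionA D χ` deleted): for `(q,dh) = 1`, `q < D` prime,
`‖λ̃(q,dh;1−β_j) − (1−u)²‖ ≤ 1372·α log q/q` for all `D ≥ exp(10|c′|π + 400)` and EVERY real primitive `χ`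
— no hypothesis on `L(1,χ)`. [cite: Zhang2022LandauSiegel, App. A p. 102] -/
theorem stepA_u014_free (c' : ℝ) :
    ∃ C : ℝ, ForAllLarge fun D _ _ => ∀ j ∈ ({1, 2, 3} : Finset ℕ), ∀ d h : ℕ,
      1 ≤ d → 1 ≤ h → ((d * h : ℕ) : ℝ) < bigP D / bigT D ^ 2 → ∀ q : ℕ, q.Prime → q < D →
        Nat.Coprime q D → Nat.Coprime q (d * h) →
          ‖lamTilde c' D q (d * h) (1 - betaJ c' D j) - (1 - uA q) ^ 2‖ ≤
            C * (alpha D * Real.log q / q) := by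
  refine ⟨1372, ⌈Real.exp (10 * |c'| * π + 400)⌉₊, fun D _ _ hD _ _ j _ d h _ _ _ q hq hqD _ hqdh => ?_⟩
  have hD' : Real.exp (10 * |c'| * π + 400) ≤ D := le_trans (Nat.le_ceil _) (by exact_mod_cast hD)
  obtain ⟨hℓ3, hα, hB, hαℓ⟩ := largeD_bounds c' hD'
  set B : ℝ := |b1 c' D| + |b2 c' D| + |b3 c' D| with hBdef
  have hq2 : (2 : ℝ) ≤ q := by exact_mod_cast hq.two_le
  have hq0 : (0 : ℝ) < q := by linarith
  have hlogq : Real.log q ≤ ell D := by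
    rw [ell]; exact Real.log_le_log hq0 (by exact_mod_cast hqD.le)
  have hlogq0 : 0 ≤ Real.log q := Real.log_nonneg (by linarith)
  -- the single factor
  have hlam : lamTilde c' D q (d * h) (1 - betaJ c' D j) =
      (1 - (q : ℂ) ^ (-(1 - betaJ c' D j + beta1 c' D))) *
        (1 - (q : ℂ) ^ (-(1 - betaJ c' D j + beta2 c' D))) *
          (1 - (q : ℂ) ^ (-(1 - betaJ c' D j + beta3 c' D))) /
        (1 - (q : ℂ) ^ (-(1 - betaJ c' D j))) := by
    unfold lamTilde
    rw [hq.primeFactors, Finset.filter_singleton, if_pos hqdh, Finset.prod_singleton]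
  rw [hlam]
  -- exponents `−1 + w`
  have e1 : -(1 - betaJ c' D j + beta1 c' D) = -1 + (betaJ c' D j - beta1 c' D) := by ring
  have e2 : -(1 - betaJ c' D j + beta2 c' D) = -1 + (betaJ c' D j - beta2 c' D) := by ring
  have e3 : -(1 - betaJ c' D j + beta3 c' D) = -1 + (betaJ c' D j - beta3 c' D) := by ring
  have e0 : -(1 - betaJ c' D j) = -1 + betaJ c' D j := by ring
  rw [e1, e2, e3, e0]
  obtain ⟨n1, n2, n3⟩ := norm_beta_eq c' D
  have hj := norm_betaJ_le c' D j
  have hw : ∀ {w : ℂ}, ‖w‖ ≤ 2 * B →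
      ‖(q : ℂ) ^ (-1 + w) - (q : ℂ)⁻¹‖ ≤ (q : ℝ)⁻¹ * (4 * B * Real.log q) := fun {w} hw => by
    have hcond : ‖w‖ * Real.log q ≤ 1 := by
      calc ‖w‖ * Real.log q ≤ 2 * B * ell D := mul_le_mul hw hlogq hlogq0 (by positivity)
        _ ≤ 2 * (7 * alpha D) * ell D := by gcongr
        _ ≤ 1 := by nlinarith
    calc ‖(q : ℂ) ^ (-1 + w) - (q : ℂ)⁻¹‖ ≤ (q : ℝ)⁻¹ * (2 * ‖w‖ * Real.log q) :=
          norm_cpow_neg_one_add_sub_inv_le hq.pos hcond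
      _ ≤ (q : ℝ)⁻¹ * (4 * B * Real.log q) := by
          apply mul_le_mul_of_nonneg_left _ (by positivity); nlinarith
  have a1 := abs_nonneg (b1 c' D); have a2 := abs_nonneg (b2 c' D); have a3 := abs_nonneg (b3 c' D)
  have w1 : ‖betaJ c' D j - beta1 c' D‖ ≤ 2 * B := by
    calc _ ≤ ‖betaJ c' D j‖ + ‖beta1 c' D‖ := norm_sub_le _ _
      _ ≤ 2 * B := by rw [n1]; linarith
  have w2 : ‖betaJ c' D j - beta2 c' D‖ ≤ 2 * B := by
    calc _ ≤ ‖betaJ c' D j‖ + ‖beta2 c' D‖ := norm_sub_le _ _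
      _ ≤ 2 * B := by rw [n2]; linarith
  have w3 : ‖betaJ c' D j - beta3 c' D‖ ≤ 2 * B := by
    calc _ ≤ ‖betaJ c' D j‖ + ‖beta3 c' D‖ := norm_sub_le _ _
      _ ≤ 2 * B := by rw [n3]; linarith
  have w0 : ‖betaJ c' D j‖ ≤ 2 * B := by linarith [norm_nonneg (betaJ c' D j)]
  set δ : ℝ := (q : ℝ)⁻¹ * (4 * B * Real.log q) with hδ
  have hu : ‖((q : ℂ))⁻¹‖ ≤ 1 / 2 := by
    rw [norm_inv, Complex.norm_natCast]; exact inv_le_of_inv_le₀ (by norm_num) (by linarith)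
  have hδle : δ ≤ 1 / 4 := by
    have : 4 * B * Real.log q ≤ 4 * (7 * alpha D) * ell D := by gcongr
    have hq' : (q : ℝ)⁻¹ ≤ 1 / 2 := inv_le_of_inv_le₀ (by norm_num) (by linarith)
    calc δ ≤ (1 / 2) * (4 * (7 * alpha D) * ell D) :=
          mul_le_mul hq' this (by positivity) (by norm_num)
      _ ≤ 1 / 4 := by nlinarith
  have key := norm_frac3_sub_sq_le hδle hu (hw w1) (hw w2) (hw w3) (hw w0)
  have huA : uA q = ((q : ℂ))⁻¹ := rfl
  rw [huA]
  calc _ ≤ 49 * δ := key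
    _ = 196 * B * (Real.log q / q) := by rw [hδ]; ring
    _ ≤ 196 * (7 * alpha D) * (Real.log q / q) := by gcongr
    _ = 1372 * (alpha D * Real.log q / q) := by ring

/-! ## Z22:§A.u015 guard-free: the first factor of `𝔱_j` is `1 − vu + O(α log q/q)` -/

/-- **Z22:§A.u015, GUARD-FREE** (App. A p. 102, tex L5051; twin of `Lemma83.stepA_u015_holds` with the
unused binder `AssumptionA D χ` deleted): under `|s − 1| < 5α`, `q < D`, `(q,D) = 1`,
`‖(1−χ(q)q^{−s−β_{j+1}})(1−χ(q)q^{−s−β_{j+2}})/(1−χ(q)q^{−s}) − (1 − vu)‖ ≤ 504·α log q/q`, all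
`D ≥ exp(10|c′|π + 400)`, every real primitive `χ` — no hypothesis on `L(1,χ)`.
[cite: Zhang2022LandauSiegel, App. A p. 102] -/
theorem stepA_u015_free (c' : ℝ) :
    ∃ C : ℝ, ForAllLarge fun D _ χ => ∀ j ∈ ({1, 2, 3} : Finset ℕ), ∀ q : ℕ,
      q.Prime → ∀ s : ℂ, CondA9 D s q →
        ‖pref c' χ j s q - (1 - vA χ q * uA q)‖ ≤ C * (alpha D * Real.log q / q) := by
  refine ⟨504, ⌈Real.exp (10 * |c'| * π + 400)⌉₊, fun D _ χ hD _ _ j _ q hq s hcond => ?_⟩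
  have hD' : Real.exp (10 * |c'| * π + 400) ≤ D := le_trans (Nat.le_ceil _) (by exact_mod_cast hD)
  obtain ⟨hℓ3, hα, hB, hαℓ⟩ := largeD_bounds c' hD'
  obtain ⟨hs, hqD, _⟩ := hcond
  set B : ℝ := |b1 c' D| + |b2 c' D| + |b3 c' D| with hBdef
  have hq2 : (2 : ℝ) ≤ q := by exact_mod_cast hq.two_le
  have hq0 : (0 : ℝ) < q := by linarith
  have hlogq : Real.log q ≤ ell D := by
    rw [ell]; exact Real.log_le_log hq0 (by exact_mod_cast hqD.le)
  have hlogq0 : 0 ≤ Real.log q := Real.log_nonneg (by linarith)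
  -- exponents `−1 + w`
  have e1 : -(s + betaJ c' D (j + 1)) = -1 + ((1 - s) - betaJ c' D (j + 1)) := by ring
  have e2 : -(s + betaJ c' D (j + 2)) = -1 + ((1 - s) - betaJ c' D (j + 2)) := by ring
  have e0 : -s = -1 + (1 - s) := by ring
  unfold pref
  rw [e1, e2, e0]
  have hs' : ‖1 - s‖ ≤ 5 * alpha D := by rw [← norm_neg, neg_sub]; exact hs.le
  have hw : ∀ {w : ℂ}, ‖w‖ ≤ 12 * alpha D →
      ‖(q : ℂ) ^ (-1 + w) - (q : ℂ)⁻¹‖ ≤ (q : ℝ)⁻¹ * (24 * alpha D * Real.log q) := fun {w} hw => by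
    have hcond : ‖w‖ * Real.log q ≤ 1 := by
      calc ‖w‖ * Real.log q ≤ 12 * alpha D * ell D := mul_le_mul hw hlogq hlogq0 (by positivity)
        _ ≤ 1 := by nlinarith
    calc ‖(q : ℂ) ^ (-1 + w) - (q : ℂ)⁻¹‖ ≤ (q : ℝ)⁻¹ * (2 * ‖w‖ * Real.log q) :=
          norm_cpow_neg_one_add_sub_inv_le hq.pos hcond
      _ ≤ (q : ℝ)⁻¹ * (24 * alpha D * Real.log q) := by
          apply mul_le_mul_of_nonneg_left _ (by positivity); nlinarith
  have hj1 := norm_betaJ_le c' D (j + 1)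
  have hj2 := norm_betaJ_le c' D (j + 2)
  have w1 : ‖(1 - s) - betaJ c' D (j + 1)‖ ≤ 12 * alpha D := by
    calc _ ≤ ‖1 - s‖ + ‖betaJ c' D (j + 1)‖ := norm_sub_le _ _
      _ ≤ 12 * alpha D := by linarith
  have w2 : ‖(1 - s) - betaJ c' D (j + 2)‖ ≤ 12 * alpha D := by
    calc _ ≤ ‖1 - s‖ + ‖betaJ c' D (j + 2)‖ := norm_sub_le _ _
      _ ≤ 12 * alpha D := by linarith
  have w0 : ‖(1 : ℂ) - s‖ ≤ 12 * alpha D := by linarith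
  set δ : ℝ := (q : ℝ)⁻¹ * (24 * alpha D * Real.log q) with hδ
  have hu : ‖((q : ℂ))⁻¹‖ ≤ 1 / 2 := by
    rw [norm_inv, Complex.norm_natCast]; exact inv_le_of_inv_le₀ (by norm_num) (by linarith)
  have hv : ‖χ (q : ZMod D)‖ ≤ 1 := χ.norm_le_one _
  have hδle : δ ≤ 1 / 4 := by
    have : 24 * alpha D * Real.log q ≤ 24 * alpha D * ell D := by gcongr
    have hq' : (q : ℝ)⁻¹ ≤ 1 / 2 := inv_le_of_inv_le₀ (by norm_num) (by linarith)
    calc δ ≤ (1 / 2) * (24 * alpha D * ell D) :=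
          mul_le_mul hq' this (by positivity) (by norm_num)
      _ ≤ 1 / 4 := by nlinarith
  have key := norm_frac2_sub_le hδle hu hv (hw w1) (hw w2) (hw w0)
  have huA : uA q = ((q : ℂ))⁻¹ := rfl
  have hvA : vA χ q = χ (q : ZMod D) := rfl
  rw [huA, hvA]
  calc _ ≤ 21 * δ := key
    _ = 504 * (alpha D * Real.log q / q) := by rw [hδ]; ring


end Literature.NumberTheory.LFunctions.Zhang2022.Repair.Gap

end
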